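import Summits.KontsevichZagierPeriods.KontsevichZagierPeriods.Theorems.UnfoldedStokesStokesGenerationStubRungClampedDlogCertificate
import Summits.KontsevichZagierPeriods.KontsevichZagierPeriods.Theorems.UnfoldedStokesStokesGenerationStubRungClampedAngularCertificateAux
import Summits.KontsevichZagierPeriods.KontsevichZagierPeriods.Theorems.UnfoldedStokesStokesGenerationStubRungDlogProd
import Summits.KontsevichZagierPeriods.KontsevichZagierPeriods.Theorems.UnfoldedStokesStokesGenerationFibrewiseRungRelations
import Summits.KontsevichZagierPeriods.KontsevichZagierPeriods.Theorems.UnfoldedStokesDefs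
import Literature.NumberTheory.Transcendental.KZCubicalCalculus
import Mathlib.Topology.Algebra.Polynomial
import Mathlib.Analysis.Calculus.Deriv.Polynomial
import Mathlib.MeasureTheory.Constructions.Pi

/-!
# `StokesGeneration` (stmt-KontsevichZagierPeriods-3586), line `fibrewise_stokes` — rung 7: rule (2) between different sub-intervals (dlog layer)

Crux `Summit.KontsevichZagierPeriods.KontsevichZagierPeriods.Theses.UnfoldedStokes.StokesGeneration` (kernel-checked
equivalent to the summit). Line `fibrewise_stokes` reduces it to the residual S2: every bounded closed-cube integrand of
value `0` is fibrewise-Stokes decomposable (`FibStokesDecomposable`) — WITHOUT the change-of-variables move.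

Rungs 2′/2″ put the rule-(2) relators of ISOTOPIES of the interval and of the square in S2's economy, rung 6 the
transposition. This file treats rule (2) between DIFFERENT DOMAINS, in the form the cubification of chains needs it:
the affine change of variables `[0,1] → [c,1]`, `u ↦ c + (1 − c)u` (`c ∈ (0,1)` algebraic), applied to a dlog atom
`γp′/p` (`p > 0` on `[0,1]`, real algebraic coefficients, `γ` real algebraic). Cubified, its relator is the interval
integrand `1_{(c,1]}·γp′/p − (1 − c)·γ(p′/p)(c + (1 − c)·)`, of value `0`; it is `γP′/P` off `{c}` for the KINKED closed
loop `P(u) = p(max u c)/p(c + (1 − c)u)` (`P(0) = P(1) = 1`, `P > 0`, one algebraic kink at `c`), so rung 1's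
two-element divergence certificate with kinks (`stub_rungClampedDlogCertificate`, p129687) decomposes it on `[0,1]²`
with the null line `{x₀ = c}` — Baker-free. Clamping (`max u c`) is exactly how S1 (`stub_cubifyKernel`) sees sub-boxes,
so this is the mechanism by which S2's economy absorbs restrictions to sub-domains. Kernel form:
`of_mem_relations_subintervalDlog`; through the definition: `fibStokesDecomposable_subintervalDlog`.

References: M. Kontsevich, D. Zagier, *Periods* (2001), §1.2 rule (2); J. Ayoub, Ann. of Math. 181 (2015), Rem. 1.5.
-/

noncomputable section

set_option linter.dupNamespace false

namespace Summit.KontsevichZagierPeriods.KontsevichZagierPeriods.Cruxes.StokesGeneration.FibrewiseStokes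

open MeasureTheory Set
open Literature.NumberTheory.Transcendental
open Literature.NumberTheory.Transcendental.KZ
open Literature.ModelTheory.ExponentialFields (IsSemialgebraic)

/-! ## Rung 7: rule (2) between DIFFERENT sub-intervals on the dlog layer (lead c4, wave 5) — assembly -/

/-- **S2 for the affine sub-interval change of variables on the dlog layer (rung 7, assembled; lead c4).** For a positive
polynomial `p` with real algebraic coefficients on `[0,1]`, algebraic `c ∈ (0,1)` and `γ`, the CUBIFIED rule-(2) relator
of the affine map `[0,1] → [c,1]`, `u ↦ c + (1 − c)u`, applied to the dlog atom `γp′/p` — the interval integrand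
`1_{(c,1]}·γp′/p − (1 − c)·γ(p′/p)(c + (1 − c)·)` (value `0` automatically) — satisfies the conclusion of
`FibrewiseStokesGeneration` with `M′ = 2`, two elements, null set `{x₀ = c}`: it is `γP′/P` for the KINKED closed loop
`P(u) = p(max u c)/p(c + (1 − c)u)` (`P(0) = P(1) = 1`, `P > 0`, one kink at `c`), certified by rung 1's divergence
certificate with kinks (`stub_rungClampedDlogCertificate`). Rule (2) between different domains, in S2's economy,
Baker-free. [cite: KontsevichZagier2001, §1.2 rule (2)] -/
theorem fibrewiseStokesGeneration_subintervalDlog :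
    ∀ (γ c : ℝ) (p : Polynomial ℝ), IsAlgebraic ℚ γ → IsAlgebraic ℚ c → (∀ n, IsAlgebraic ℚ (p.coeff n)) →
      0 < c → c < 1 → (∀ u ∈ Set.Icc (0:ℝ) 1, 0 < p.eval u) →
      ∀ (t : IntegralRep 1), t.domain = Set.pi Set.univ (fun _ : Fin 1 => Set.Icc (0:ℝ) 1) →
      (∀ z ∈ Set.pi Set.univ (fun _ : Fin 1 => Set.Icc (0:ℝ) 1), t.integrand z =
        γ * ((if c < z 0 then (Polynomial.derivative p).eval (z 0) / p.eval (z 0) else 0) -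
          (1 - c) * (Polynomial.derivative p).eval (c + (1 - c) * z 0) / p.eval (c + (1 - c) * z 0))) →
    ∃ (M' : ℕ) (hMM' : 1 ≤ M') (J : ℕ) (i : Fin J → Fin M') (G D : Fin J → (Fin M' → ℝ) → ℝ)
      (K : Fin J → Set (Fin M' → ℝ)) (q : Fin J → IntegralRep M') (Z : Set (Fin M' → ℝ)),
      (∀ j, IsSemialgebraicFunOn ℚ (Set.pi Set.univ (fun _ : Fin M' => Set.Icc (0:ℝ) 1)) (G j) ∧
        IsSemialgebraicFunOn ℚ (Set.pi Set.univ (fun _ : Fin M' => Set.Icc (0:ℝ) 1)) (D j) ∧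
        IsSemialgebraic ℚ (K j) ∧
        (∃ B : ℝ, ∀ x ∈ Set.pi Set.univ (fun _ : Fin M' => Set.Icc (0:ℝ) 1), |(G j) x| ≤ B) ∧
        (∀ x ∈ Set.pi Set.univ (fun _ : Fin M' => Set.Icc (0:ℝ) 1), Set.Finite {s : ℝ | Function.update x (i j) s ∈ (K j)}) ∧
        (∀ x ∈ Set.pi Set.univ (fun _ : Fin M' => Set.Icc (0:ℝ) 1), ContinuousOn (fun s : ℝ => (G j) (Function.update x (i j) s)) (Set.Icc (0:ℝ) 1)) ∧
        (∀ x ∈ Set.pi Set.univ (fun _ : Fin M' => Set.Icc (0:ℝ) 1), x ∉ (K j) → x (i j) ∈ Set.Ioo (0:ℝ) 1 →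
          HasDerivAt (fun s : ℝ => (G j) (Function.update x (i j) s)) ((D j) x) (x (i j)))) ∧
      (∀ j, (q j).domain = Set.pi Set.univ (fun _ : Fin M' => Set.Icc (0:ℝ) 1) ∧
        ∀ x ∈ Set.pi Set.univ (fun _ : Fin M' => Set.Icc (0:ℝ) 1), (q j).integrand x =
          D j x - (G j (Function.update x (i j) 1) - G j (Function.update x (i j) 0))) ∧
      IsSemialgebraic ℚ Z ∧ volume Z = 0 ∧
      ∀ x ∈ Set.pi Set.univ (fun _ : Fin M' => Set.Icc (0:ℝ) 1), x ∉ Z →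
        t.integrand (fun l => x (Fin.castLE hMM' l)) = ∑ j, (q j).integrand x := by
  intro γ c p hγ hc hp hc0 hc1 hppos t _ hti
  classical
  set S : Set (Fin 2 → ℝ) := Set.pi Set.univ (fun _ : Fin 2 => Set.Icc (0:ℝ) 1) with hS
  have hSsa : IsSemialgebraic ℚ S := by rw [hS, ← cube_eq_pi]; exact isSemialgebraic_cube
  have h12 : (1 : ℕ) ≤ 2 := by norm_num
  have hmem : ∀ x ∈ S, ∀ i, x i ∈ Set.Icc (0:ℝ) 1 := fun x hx i => hx i (Set.mem_univ _)
  have hpd_alg : ∀ n, IsAlgebraic ℚ ((Polynomial.derivative p).coeff n) := isAlgebraic_coeff_derivative hp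
  have h1c : 0 < 1 - c := by linarith
  have h1c_alg : IsAlgebraic ℚ (1 - c) := isAlgebraic_one.sub hc
  -- the affine map `α u = c + (1 − c) u` and the clamp `max u c` keep `[0,1]` inside `[c,1] ⊆ [0,1]`
  set α : ℝ → ℝ := fun u => c + (1 - c) * u with hα
  have hα_mem : ∀ u ∈ Set.Icc (0:ℝ) 1, α u ∈ Set.Icc (0:ℝ) 1 := fun u hu => by
    simp only [hα]; constructor <;> nlinarith [hu.1, hu.2]
  have hmax_mem : ∀ u ∈ Set.Icc (0:ℝ) 1, max u c ∈ Set.Icc (0:ℝ) 1 := fun u hu =>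
    ⟨le_max_of_le_left hu.1, max_le hu.2 hc1.le⟩
  have hα_der : ∀ u, HasDerivAt α (1 - c) u := fun u => by
    simpa [hα] using ((hasDerivAt_id u).const_mul (1 - c)).const_add c
  -- the kinked loop and its derivative
  set P : ℝ → ℝ := fun u => p.eval (max u c) / p.eval (α u) with hP
  set χ : ℝ → ℝ := fun u => if c < u ∧ u < 2 then (1:ℝ) else 0 with hχ
  set P' : ℝ → ℝ := fun u =>
    (χ u * (Polynomial.derivative p).eval u * p.eval (α u) - p.eval (max u c) * ((1 - c) * (Polynomial.derivative p).eval (α u))) / p.eval (α u) ^ 2 with hP'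
  have hpα_pos : ∀ u ∈ Set.Icc (0:ℝ) 1, 0 < p.eval (α u) := fun u hu => hppos _ (hα_mem u hu)
  have hpmax_pos : ∀ u ∈ Set.Icc (0:ℝ) 1, 0 < p.eval (max u c) := fun u hu => hppos _ (hmax_mem u hu)
  have hPpos : ∀ u ∈ Set.Icc (0:ℝ) 1, 0 < P u := fun u hu => div_pos (hpmax_pos u hu) (hpα_pos u hu)
  have hP0 : P 0 = 1 := by
    simp only [hP, hα, max_eq_right hc0.le, mul_zero, add_zero]
    exact div_self (hppos c ⟨hc0.le, hc1.le⟩).ne'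
  have hP1 : P 1 = 1 := by
    simp only [hP, hα, max_eq_left hc1.le, mul_one, add_sub_cancel]
    exact div_self (hppos 1 ⟨zero_le_one, le_rfl⟩).ne'
  -- semialgebraicity of `P`, `P'` as functions of `x 0` on the square
  have hx0 : IsSemialgebraicFunOn ℚ S (fun x => x 0) := isSemialgebraicFunOn_apply hSsa 0
  have hcS : IsSemialgebraicFunOn ℚ S (fun _ => c) := isSemialgebraicFunOn_const_of_isAlgebraic hSsa hc
  have h1cS : IsSemialgebraicFunOn ℚ S (fun _ => 1 - c) := isSemialgebraicFunOn_const_of_isAlgebraic hSsa h1c_alg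
  have hαS : IsSemialgebraicFunOn ℚ S (fun x => α (x 0)) := by
    simpa [hα] using hcS.fun_add (h1cS.fun_mul hx0)
  have hmaxS : IsSemialgebraicFunOn ℚ S (fun x => max (x 0) c) := rungClamp_sa_max hx0 hcS
  have hpαS : IsSemialgebraicFunOn ℚ S (fun x => p.eval (α (x 0))) := rungClamp_sa_eval_comp hαS hp
  have hpdαS : IsSemialgebraicFunOn ℚ S (fun x => (Polynomial.derivative p).eval (α (x 0))) := rungClamp_sa_eval_comp hαS hpd_alg
  have hpmaxS : IsSemialgebraicFunOn ℚ S (fun x => p.eval (max (x 0) c)) := rungClamp_sa_eval_comp hmaxS hp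
  have hpdS : IsSemialgebraicFunOn ℚ S (fun x => (Polynomial.derivative p).eval (x 0)) := isSemialgebraicFunOn_eval_apply hSsa hpd_alg 0
  have hχS : IsSemialgebraicFunOn ℚ S (fun x => χ (x 0)) := by
    have h2 : IsAlgebraic ℚ (2:ℝ) := by simpa using isAlgebraic_nat (R := ℚ) (A := ℝ) 2
    simpa [hχ] using rungClamp_sa_indicator hSsa hc h2 0
  have hpαS_ne : ∀ x ∈ S, p.eval (α (x 0)) ≠ 0 := fun x hx => (hpα_pos _ (hmem x hx 0)).ne'
  have hPS : IsSemialgebraicFunOn ℚ S (fun x => P (x 0)) := hpmaxS.div hpαS hpαS_ne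
  have hP'S : IsSemialgebraicFunOn ℚ S (fun x => P' (x 0)) :=
    (((hχS.fun_mul hpdS).fun_mul hpαS).fun_sub (hpmaxS.fun_mul (h1cS.fun_mul hpdαS))).div (hpαS.fun_pow 2)
      fun x hx => pow_ne_zero 2 (hpαS_ne x hx)
  -- continuity of `P` and a bound for `P'` on `[0,1]`
  have hαc : Continuous α := by
    show Continuous fun u => c + (1 - c) * u
    fun_prop
  have hPc : ContinuousOn P (Set.Icc (0:ℝ) 1) :=
    ((p.continuous.comp (continuous_id.max continuous_const)).continuousOn).div
      ((p.continuous.comp hαc).continuousOn) fun u hu => (hpα_pos u hu).ne'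
  obtain ⟨Bp, hBp⟩ := isCompact_Icc.exists_bound_of_continuousOn (p.continuousOn (s := Set.Icc (0:ℝ) 1))
  obtain ⟨Bd, hBd⟩ := isCompact_Icc.exists_bound_of_continuousOn ((Polynomial.derivative p).continuousOn (s := Set.Icc (0:ℝ) 1))
  obtain ⟨u₀, hu₀, hmin⟩ := isCompact_Icc.exists_isMinOn (Set.nonempty_Icc.mpr zero_le_one)
    (p.continuousOn (s := Set.Icc (0:ℝ) 1))
  set m := p.eval u₀ with hm
  have hm0 : 0 < m := hppos u₀ hu₀
  have hmle : ∀ u ∈ Set.Icc (0:ℝ) 1, m ≤ p.eval u := fun u hu => hmin hu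
  have hBp0 : 0 ≤ Bp := (norm_nonneg _).trans (hBp 0 ⟨le_rfl, zero_le_one⟩)
  have hBd0 : 0 ≤ Bd := (norm_nonneg _).trans (hBd 0 ⟨le_rfl, zero_le_one⟩)
  have hP'bd : ∃ B : ℝ, ∀ u ∈ Set.Icc (0:ℝ) 1, |P' u| ≤ B := by
    refine ⟨(Bd * Bp + Bp * ((1 - c) * Bd)) / m ^ 2, fun u hu => ?_⟩
    have hχle : |χ u| ≤ 1 := by simp only [hχ]; split_ifs <;> simp
    have hb1 : |(Polynomial.derivative p).eval u| ≤ Bd := by simpa only [Real.norm_eq_abs] using hBd u hu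
    have hb2 : |p.eval (α u)| ≤ Bp := by simpa only [Real.norm_eq_abs] using hBp _ (hα_mem u hu)
    have hb3 : |p.eval (max u c)| ≤ Bp := by simpa only [Real.norm_eq_abs] using hBp _ (hmax_mem u hu)
    have hb4 : |(Polynomial.derivative p).eval (α u)| ≤ Bd := by
      simpa only [Real.norm_eq_abs] using hBd _ (hα_mem u hu)
    have hnum : |χ u * (Polynomial.derivative p).eval u * p.eval (α u) -
        p.eval (max u c) * ((1 - c) * (Polynomial.derivative p).eval (α u))| ≤ Bd * Bp + Bp * ((1 - c) * Bd) := by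
      refine (abs_sub _ _).trans (add_le_add ?_ ?_)
      · rw [abs_mul, abs_mul]
        calc |χ u| * |(Polynomial.derivative p).eval u| * |p.eval (α u)| ≤ 1 * Bd * Bp :=
              mul_le_mul (mul_le_mul hχle hb1 (abs_nonneg _) zero_le_one) hb2 (abs_nonneg _) (by positivity)
          _ = Bd * Bp := by ring
      · rw [abs_mul, abs_mul, abs_of_pos h1c]
        exact mul_le_mul hb3 (mul_le_mul_of_nonneg_left hb4 h1c.le) (by positivity) hBp0
    have hden : m ^ 2 ≤ p.eval (α u) ^ 2 := pow_le_pow_left₀ hm0.le (hmle _ (hα_mem u hu)) 2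
    simp only [hP']
    rw [abs_div, abs_of_pos (pow_pos (hpα_pos u hu) 2)]
    exact div_le_div₀ (by positivity) hnum (by positivity) hden
  -- the derivative of `P` off the kink `c`
  have hPder : ∀ u ∈ Set.Ioo (0:ℝ) 1, u ∉ ({c} : Finset ℝ) → HasDerivAt P (P' u) u := by
    intro u hu huc
    rw [Finset.mem_singleton] at huc
    have hu' : u ∈ Set.Icc (0:ℝ) 1 := ⟨hu.1.le, hu.2.le⟩
    have hden : HasDerivAt (fun s => p.eval (α s)) ((Polynomial.derivative p).eval (α u) * (1 - c)) u :=
      (p.hasDerivAt (α u)).comp u (hα_der u)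
    have hne : p.eval (α u) ≠ 0 := (hpα_pos u hu').ne'
    rcases lt_or_gt_of_ne huc with h | h
    · -- `u < c`: the numerator is the constant `p c` near `u`
      have hev : ∀ᶠ s in nhds u, P s = p.eval c / p.eval (α s) := by
        filter_upwards [Iio_mem_nhds h] with s hs
        simp only [hP, max_eq_right (le_of_lt (Set.mem_Iio.mp hs))]
      have hd : HasDerivAt (fun s => p.eval c / p.eval (α s))
          ((0 * p.eval (α u) - p.eval c * ((Polynomial.derivative p).eval (α u) * (1 - c))) / p.eval (α u) ^ 2) u :=
        (hasDerivAt_const u (p.eval c)).div hden hne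
      refine (hd.congr_of_eventuallyEq hev).congr_deriv ?_
      have hχ0 : χ u = 0 := by simp only [hχ]; rw [if_neg]; exact fun h' => lt_asymm h h'.1
      simp only [hP', hχ0, max_eq_right h.le]
      ring
    · -- `c < u`: the numerator is `p s` near `u`
      have hev : ∀ᶠ s in nhds u, P s = p.eval s / p.eval (α s) := by
        filter_upwards [Ioi_mem_nhds h] with s hs
        simp only [hP, max_eq_left (le_of_lt (Set.mem_Ioi.mp hs))]
      have hd : HasDerivAt (fun s => p.eval s / p.eval (α s))
          (((Polynomial.derivative p).eval u * p.eval (α u) - p.eval u * ((Polynomial.derivative p).eval (α u) * (1 - c))) / p.eval (α u) ^ 2) u :=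
        (p.hasDerivAt u).div hden hne
      refine (hd.congr_of_eventuallyEq hev).congr_deriv ?_
      have hχ1 : χ u = 1 := by simp only [hχ]; rw [if_pos ⟨h, by linarith [hu.2]⟩]
      simp only [hP', hχ1, max_eq_left h.le]
      ring
  -- the certificate with one kink
  obtain ⟨G, D, K, q, hGD, hq, hid⟩ := stub_rungClampedDlogCertificate γ P P' {c} hγ (by simpa using hc)
    hPS hP'S hPpos hP0 hP1 hPc hP'bd hPder
  -- the null line `x₀ = c` and the conclusion
  refine ⟨2, h12, 2, fun j => j, G, D, K, q, {x | x 0 = c}, hGD, hq,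
    isSemialgebraic_setOf_apply_eq_of_isAlgebraic hc 0, by rw [volume_pi]; exact Measure.pi_hyperplane _ _ _,
    fun x hx hxc => ?_⟩
  have hx1 : (fun l : Fin 1 => x (Fin.castLE h12 l)) ∈ Set.pi Set.univ (fun _ : Fin 1 => Set.Icc (0:ℝ) 1) :=
    fun l _ => hx _ (Set.mem_univ _)
  have hxc' : x 0 ≠ c := hxc
  have hx0m : x 0 ∈ Set.Icc (0:ℝ) 1 := hmem x hx 0
  rw [hti _ hx1, ← hid x hx (by simpa using hxc')]
  show γ * ((if c < x 0 then (Polynomial.derivative p).eval (x 0) / p.eval (x 0) else 0) -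
      (1 - c) * (Polynomial.derivative p).eval (c + (1 - c) * x 0) / p.eval (c + (1 - c) * x 0)) = γ * (P' (x 0) / P (x 0))
  congr 1
  have hpα : p.eval (α (x 0)) ≠ 0 := (hpα_pos _ hx0m).ne'
  -- two clean algebraic identities
  have idA : ∀ (X A dX dA : ℝ), X ≠ 0 → A ≠ 0 →
      (1 * dX * A - X * ((1 - c) * dA)) / A ^ 2 / (X / A) = dX / X - (1 - c) * dA / A := by
    intro X A dX dA hX hA
    field_simp
  have idB : ∀ (Pc A dX dA : ℝ), Pc ≠ 0 → A ≠ 0 →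
      (0 * dX * A - Pc * ((1 - c) * dA)) / A ^ 2 / (Pc / A) = 0 - (1 - c) * dA / A := by
    intro Pc A dX dA hPc hA
    field_simp
    ring
  rcases lt_or_gt_of_ne hxc' with h | h
  · have hχ0 : χ (x 0) = 0 := by simp only [hχ]; rw [if_neg]; exact fun h' => lt_asymm h h'.1
    have hpc : p.eval c ≠ 0 := (hppos c ⟨hc0.le, hc1.le⟩).ne'
    rw [if_neg (not_lt.mpr h.le)]
    simp only [hP, hP', hχ0, max_eq_right h.le]
    rw [idB _ _ _ _ hpc hpα, mul_div_assoc]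
  · have hχ1 : χ (x 0) = 1 := by simp only [hχ]; rw [if_pos ⟨h, by linarith [hx0m.2]⟩]
    have hpx : p.eval (x 0) ≠ 0 := (hppos _ hx0m).ne'
    rw [if_pos h]
    simp only [hP, hP', hχ1, max_eq_left h.le]
    rw [idA _ _ _ _ hpx hpα, mul_div_assoc]

/-- **The crux on the sub-interval dlog sector (kernel form)**: the cubified rule-(2) relator of `u ↦ c + (1 − c)u`
applied to `γp′/p` is a Kontsevich–Zagier relation (∘ the landed bridge). [cite: KontsevichZagier2001, §1.2 Conjecture 1] -/
theorem of_mem_relations_subintervalDlog (γ c : ℝ) (p : Polynomial ℝ) (hγ : IsAlgebraic ℚ γ) (hc : IsAlgebraic ℚ c)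
    (hp : ∀ n, IsAlgebraic ℚ (p.coeff n)) (hc0 : 0 < c) (hc1 : c < 1) (hppos : ∀ u ∈ Set.Icc (0:ℝ) 1, 0 < p.eval u)
    (t : IntegralRep 1) (ht : t.domain = Set.pi Set.univ (fun _ : Fin 1 => Set.Icc (0:ℝ) 1))
    (hti : ∀ z ∈ Set.pi Set.univ (fun _ : Fin 1 => Set.Icc (0:ℝ) 1), t.integrand z =
      γ * ((if c < z 0 then (Polynomial.derivative p).eval (z 0) / p.eval (z 0) else 0) -
        (1 - c) * (Polynomial.derivative p).eval (c + (1 - c) * z 0) / p.eval (c + (1 - c) * z 0))) :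
    of t ∈ relations :=
  of_mem_relations_of_fibStokesDecomposition 1 t ht
    (fibrewiseStokesGeneration_subintervalDlog γ c p hγ hc hp hc0 hc1 hppos t ht hti)

/-- Rung 7 through the route definition. [cite: KontsevichZagier2001, §1.2 rule (2)] -/
theorem fibStokesDecomposable_subintervalDlog (γ c : ℝ) (p : Polynomial ℝ) (hγ : IsAlgebraic ℚ γ)
    (hc : IsAlgebraic ℚ c) (hp : ∀ n, IsAlgebraic ℚ (p.coeff n)) (hc0 : 0 < c) (hc1 : c < 1)
    (hppos : ∀ u ∈ Set.Icc (0:ℝ) 1, 0 < p.eval u) (t : IntegralRep 1)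
    (ht : t.domain = Set.pi Set.univ (fun _ : Fin 1 => Set.Icc (0:ℝ) 1))
    (hti : ∀ z ∈ Set.pi Set.univ (fun _ : Fin 1 => Set.Icc (0:ℝ) 1), t.integrand z =
      γ * ((if c < z 0 then (Polynomial.derivative p).eval (z 0) / p.eval (z 0) else 0) -
        (1 - c) * (Polynomial.derivative p).eval (c + (1 - c) * z 0) / p.eval (c + (1 - c) * z 0))) :
    FibStokesDecomposable 1 t.integrand :=
  fibrewiseStokesGeneration_subintervalDlog γ c p hγ hc hp hc0 hc1 hppos t ht hti

end Summit.KontsevichZagierPeriods.KontsevichZagierPeriods.Cruxes.StokesGeneration.FibrewiseStokes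

end
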